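import Mathlib
import HarnessLib

/-!
# Stub `stub_seedLink` of the crux `DressedCharge` (line `birth`), helper file 1/2

Plane-wave derivations of the lattice polynomial algebra `MvPolynomial (ℤ ⊕ ℤ) ℂ`
(`X (inl x) = q_x`, `X (inr x) = p_x`) versus the harmonic linearised operator
`𝒟₀ = L₁ ∘ L₁ + 𝒲₀`.

Everything is stated for ABSTRACT derivations characterised by their values on generators
(so that no auxiliary definitions are needed): a family `D : ℂ × ℂ → Derivation` with
`D (z, μ) q_x = C (z ^ x)`, `D (z, μ) p_x = C (μ * z ^ x)` (plane waves), and `L` with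
`L q_i = p_i`, `L p_i = -(ω₂+2) q_i + q_{i+1} + q_{i-1}` (harmonic Liouville derivation).

* `D (L f) = L (D f) + μ • D f` for an admissible wave (`z ≠ 0`, `μ ^ 2 = -ω̃(z)`,
  `ω̃(z) = ω₂ + 2 - z - z⁻¹`);
* `D (τ f) = z • τ (D f)`, `D (τ⁻¹ f) = z⁻¹ • τ⁻¹ (D f)` for the lattice shifts `τ^{±1} = rename (· ± 1)`;
* the iterated versions along a list of waves `l.foldr (fun Pj acc => D Pj acc)`, and the multiplier
  identity `constantCoeff (𝐃_P (𝒟₀ w)) = t(P) * constantCoeff (𝐃_P w)`,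
  `t(P) = (∑ μ_j) ^ 2 + ω̃(∏ z_j)` (no degree hypothesis is needed: `constantCoeff ∘ L = 0`).

The registered anchor of this `--supports` file is `stub_seedLink_partI` (closed form of
`seedLink_partI`); the stub `stub_seedLink` itself is proved in
`HiddenChargeMazurDressedChargeStubSeedLink.lean`, which imports this file.
-/

noncomputable section

namespace Summit.AtomisticToContinuum.FouriersLaw.Theorems.DressedCharge

open MvPolynomial

/-! ## Generalities on derivations of the lattice algebra -/

/-- A derivation commutes with multiplication by constants. -/
theorem seedLink_derivation_C_mul
    (D : Derivation ℂ (MvPolynomial (ℤ ⊕ ℤ) ℂ) (MvPolynomial (ℤ ⊕ ℤ) ℂ)) (c : ℂ)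
    (f : MvPolynomial (ℤ ⊕ ℤ) ℂ) : D (C c * f) = C c * D f := by
  rw [Derivation.leibniz, derivation_C, smul_zero, add_zero, smul_eq_mul]

/-- Twisted commutation of a derivation with a renaming, checked on generators. -/
theorem seedLink_derivation_rename
    (D : Derivation ℂ (MvPolynomial (ℤ ⊕ ℤ) ℂ) (MvPolynomial (ℤ ⊕ ℤ) ℂ)) (g : ℤ ⊕ ℤ → ℤ ⊕ ℤ) (c : ℂ)
    (h : ∀ v, D (rename g (X v)) = c • rename g (D (X v))) (f : MvPolynomial (ℤ ⊕ ℤ) ℂ) :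
    D (rename g f) = c • rename g (D f) := by
  induction f using MvPolynomial.induction_on with
  | C a => simp
  | add p q hp hq => simp only [map_add, hp, hq, smul_add]
  | mul_X p v hp =>
    simp only [map_mul, Derivation.leibniz, smul_eq_mul, map_add, hp, h, smul_add, mul_smul_comm]

/-- A derivation mapping every generator into the augmentation ideal maps everything into it. -/
theorem seedLink_constantCoeff_derivation
    (L : Derivation ℂ (MvPolynomial (ℤ ⊕ ℤ) ℂ) (MvPolynomial (ℤ ⊕ ℤ) ℂ))
    (hL : ∀ v, constantCoeff (L (X v)) = 0) (f : MvPolynomial (ℤ ⊕ ℤ) ℂ) :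
    constantCoeff (L f) = 0 := by
  induction f using MvPolynomial.induction_on with
  | C c => simp
  | add p q hp hq => simp [hp, hq]
  | mul_X p v _ =>
    rw [Derivation.leibniz, map_add, smul_eq_mul, smul_eq_mul, map_mul, map_mul, constantCoeff_X,
      zero_mul, add_zero, hL, mul_zero]

/-! ## Iterated derivatives along a list of waves -/

/-- Additivity of the iterated derivative. -/
theorem seedLink_fold_add
    (D : ℂ × ℂ → Derivation ℂ (MvPolynomial (ℤ ⊕ ℤ) ℂ) (MvPolynomial (ℤ ⊕ ℤ) ℂ))
    (l : List (ℂ × ℂ)) (f g : MvPolynomial (ℤ ⊕ ℤ) ℂ) :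
    l.foldr (fun Pj acc => D Pj acc) (f + g) =
      l.foldr (fun Pj acc => D Pj acc) f + l.foldr (fun Pj acc => D Pj acc) g := by
  induction l with
  | nil => rfl
  | cons Pj l ih => simp [ih]

/-- The iterated derivative commutes with subtraction. -/
theorem seedLink_fold_sub
    (D : ℂ × ℂ → Derivation ℂ (MvPolynomial (ℤ ⊕ ℤ) ℂ) (MvPolynomial (ℤ ⊕ ℤ) ℂ))
    (l : List (ℂ × ℂ)) (f g : MvPolynomial (ℤ ⊕ ℤ) ℂ) :
    l.foldr (fun Pj acc => D Pj acc) (f - g) =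
      l.foldr (fun Pj acc => D Pj acc) f - l.foldr (fun Pj acc => D Pj acc) g := by
  induction l with
  | nil => rfl
  | cons Pj l ih => simp [ih]

/-- The iterated derivative is `ℂ`-homogeneous. -/
theorem seedLink_fold_smul
    (D : ℂ × ℂ → Derivation ℂ (MvPolynomial (ℤ ⊕ ℤ) ℂ) (MvPolynomial (ℤ ⊕ ℤ) ℂ))
    (l : List (ℂ × ℂ)) (c : ℂ) (f : MvPolynomial (ℤ ⊕ ℤ) ℂ) :
    l.foldr (fun Pj acc => D Pj acc) (c • f) = c • l.foldr (fun Pj acc => D Pj acc) f := by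
  induction l with
  | nil => rfl
  | cons Pj l ih => simp [ih]

/-- The iterated derivative commutes with multiplication by constants. -/
theorem seedLink_fold_C_mul
    (D : ℂ × ℂ → Derivation ℂ (MvPolynomial (ℤ ⊕ ℤ) ℂ) (MvPolynomial (ℤ ⊕ ℤ) ℂ))
    (l : List (ℂ × ℂ)) (c : ℂ) (f : MvPolynomial (ℤ ⊕ ℤ) ℂ) :
    l.foldr (fun Pj acc => D Pj acc) (C c * f) = C c * l.foldr (fun Pj acc => D Pj acc) f := by
  rw [C_mul', seedLink_fold_smul, C_mul']

/-- The iterated derivative kills `0`. -/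
theorem seedLink_fold_zero
    (D : ℂ × ℂ → Derivation ℂ (MvPolynomial (ℤ ⊕ ℤ) ℂ) (MvPolynomial (ℤ ⊕ ℤ) ℂ))
    (l : List (ℂ × ℂ)) :
    l.foldr (fun Pj acc => D Pj acc) (0 : MvPolynomial (ℤ ⊕ ℤ) ℂ) = 0 := by
  induction l with
  | nil => rfl
  | cons Pj l ih => simp [ih]

/-! ## Plane waves versus the shifts -/

/-- `D (τ f) = z • τ (D f)` for the shift `τ = rename (· + 1)`. -/
theorem seedLink_D_tau
    {D : ℂ × ℂ → Derivation ℂ (MvPolynomial (ℤ ⊕ ℤ) ℂ) (MvPolynomial (ℤ ⊕ ℤ) ℂ)}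
    (hDl : ∀ (Pj : ℂ × ℂ) (x : ℤ), D Pj (X (Sum.inl x)) = C (Pj.1 ^ x))
    (hDr : ∀ (Pj : ℂ × ℂ) (x : ℤ), D Pj (X (Sum.inr x)) = C (Pj.2 * Pj.1 ^ x))
    (Pj : ℂ × ℂ) (hz : Pj.1 ≠ 0) (f : MvPolynomial (ℤ ⊕ ℤ) ℂ) :
    D Pj (rename (Sum.map (fun i : ℤ => i + 1) (fun i : ℤ => i + 1)) f) =
      Pj.1 • rename (Sum.map (fun i : ℤ => i + 1) (fun i : ℤ => i + 1)) (D Pj f) := by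
  refine seedLink_derivation_rename (D Pj) _ _ (fun v => ?_) f
  rcases v with i | i
  · rw [rename_X, Sum.map_inl, hDl, hDl, rename_C, smul_eq_C_mul, ← map_mul, zpow_add_one₀ hz,
      mul_comm]
  · rw [rename_X, Sum.map_inr, hDr, hDr, rename_C, smul_eq_C_mul, ← map_mul, zpow_add_one₀ hz]
    congr 1
    ring

/-- `D (τ⁻¹ f) = z⁻¹ • τ⁻¹ (D f)` for the inverse shift `τ⁻¹ = rename (· - 1)`. -/
theorem seedLink_D_tauInv
    {D : ℂ × ℂ → Derivation ℂ (MvPolynomial (ℤ ⊕ ℤ) ℂ) (MvPolynomial (ℤ ⊕ ℤ) ℂ)}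
    (hDl : ∀ (Pj : ℂ × ℂ) (x : ℤ), D Pj (X (Sum.inl x)) = C (Pj.1 ^ x))
    (hDr : ∀ (Pj : ℂ × ℂ) (x : ℤ), D Pj (X (Sum.inr x)) = C (Pj.2 * Pj.1 ^ x))
    (Pj : ℂ × ℂ) (hz : Pj.1 ≠ 0) (f : MvPolynomial (ℤ ⊕ ℤ) ℂ) :
    D Pj (rename (Sum.map (fun i : ℤ => i - 1) (fun i : ℤ => i - 1)) f) =
      (Pj.1)⁻¹ • rename (Sum.map (fun i : ℤ => i - 1) (fun i : ℤ => i - 1)) (D Pj f) := by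
  refine seedLink_derivation_rename (D Pj) _ _ (fun v => ?_) f
  rcases v with i | i
  · rw [rename_X, Sum.map_inl, hDl, hDl, rename_C, smul_eq_C_mul, ← map_mul, zpow_sub_one₀ hz,
      mul_comm]
  · rw [rename_X, Sum.map_inr, hDr, hDr, rename_C, smul_eq_C_mul, ← map_mul, zpow_sub_one₀ hz]
    congr 1
    ring

/-- Iterated commutation with `τ`: `𝐃 (τ f) = (∏ z_j) • τ (𝐃 f)`. -/
theorem seedLink_fold_tau
    {D : ℂ × ℂ → Derivation ℂ (MvPolynomial (ℤ ⊕ ℤ) ℂ) (MvPolynomial (ℤ ⊕ ℤ) ℂ)}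
    (hDl : ∀ (Pj : ℂ × ℂ) (x : ℤ), D Pj (X (Sum.inl x)) = C (Pj.1 ^ x))
    (hDr : ∀ (Pj : ℂ × ℂ) (x : ℤ), D Pj (X (Sum.inr x)) = C (Pj.2 * Pj.1 ^ x))
    (l : List (ℂ × ℂ)) (hl : ∀ Pj ∈ l, Pj.1 ≠ 0) (f : MvPolynomial (ℤ ⊕ ℤ) ℂ) :
    l.foldr (fun Pj acc => D Pj acc) (rename (Sum.map (fun i : ℤ => i + 1) (fun i : ℤ => i + 1)) f) =
      (l.map Prod.fst).prod •
        rename (Sum.map (fun i : ℤ => i + 1) (fun i : ℤ => i + 1)) (l.foldr (fun Pj acc => D Pj acc) f) := by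
  induction l with
  | nil => simp
  | cons Pj l ih =>
    have hPj := hl Pj (by simp)
    have ih' := ih (fun Q hQ => hl Q (by simp [hQ]))
    rw [List.foldr_cons, List.foldr_cons, ih', Derivation.map_smul, seedLink_D_tau hDl hDr Pj hPj,
      List.map_cons, List.prod_cons, smul_smul, mul_comm]

/-- Iterated commutation with `τ⁻¹`: `𝐃 (τ⁻¹ f) = (∏ z_j)⁻¹ • τ⁻¹ (𝐃 f)`. -/
theorem seedLink_fold_tauInv
    {D : ℂ × ℂ → Derivation ℂ (MvPolynomial (ℤ ⊕ ℤ) ℂ) (MvPolynomial (ℤ ⊕ ℤ) ℂ)}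
    (hDl : ∀ (Pj : ℂ × ℂ) (x : ℤ), D Pj (X (Sum.inl x)) = C (Pj.1 ^ x))
    (hDr : ∀ (Pj : ℂ × ℂ) (x : ℤ), D Pj (X (Sum.inr x)) = C (Pj.2 * Pj.1 ^ x))
    (l : List (ℂ × ℂ)) (hl : ∀ Pj ∈ l, Pj.1 ≠ 0) (f : MvPolynomial (ℤ ⊕ ℤ) ℂ) :
    l.foldr (fun Pj acc => D Pj acc) (rename (Sum.map (fun i : ℤ => i - 1) (fun i : ℤ => i - 1)) f) =
      ((l.map Prod.fst).prod)⁻¹ •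
        rename (Sum.map (fun i : ℤ => i - 1) (fun i : ℤ => i - 1)) (l.foldr (fun Pj acc => D Pj acc) f) := by
  induction l with
  | nil => simp
  | cons Pj l ih =>
    have hPj := hl Pj (by simp)
    have ih' := ih (fun Q hQ => hl Q (by simp [hQ]))
    rw [List.foldr_cons, List.foldr_cons, ih', Derivation.map_smul, seedLink_D_tauInv hDl hDr Pj hPj,
      List.map_cons, List.prod_cons, smul_smul, mul_inv, mul_comm]

/-! ## Plane waves versus the harmonic Liouville derivation -/

/-- `[D_(z,μ), L₁] = μ • D_(z,μ)` for an admissible wave, applied to `f`. -/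
theorem seedLink_D_L (ω₂ : ℝ)
    {L : Derivation ℂ (MvPolynomial (ℤ ⊕ ℤ) ℂ) (MvPolynomial (ℤ ⊕ ℤ) ℂ)}
    (hLl : ∀ i : ℤ, L (X (Sum.inl i)) = X (Sum.inr i))
    (hLr : ∀ i : ℤ, L (X (Sum.inr i)) =
      -(C ((ω₂ : ℂ) + 2) * X (Sum.inl i)) + X (Sum.inl (i + 1)) + X (Sum.inl (i - 1)))
    {D : ℂ × ℂ → Derivation ℂ (MvPolynomial (ℤ ⊕ ℤ) ℂ) (MvPolynomial (ℤ ⊕ ℤ) ℂ)}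
    (hDl : ∀ (Pj : ℂ × ℂ) (x : ℤ), D Pj (X (Sum.inl x)) = C (Pj.1 ^ x))
    (hDr : ∀ (Pj : ℂ × ℂ) (x : ℤ), D Pj (X (Sum.inr x)) = C (Pj.2 * Pj.1 ^ x))
    (Pj : ℂ × ℂ) (hz : Pj.1 ≠ 0) (hμ : Pj.2 ^ 2 = -((ω₂ : ℂ) + 2 - Pj.1 - (Pj.1)⁻¹))
    (f : MvPolynomial (ℤ ⊕ ℤ) ℂ) :
    D Pj (L f) = L (D Pj f) + Pj.2 • D Pj f := by
  have key : ⁅D Pj, L⁆ = Pj.2 • D Pj := by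
    refine MvPolynomial.derivation_ext (fun v => ?_)
    rw [Derivation.commutator_apply, Derivation.smul_apply]
    rcases v with i | i
    · rw [hLl, hDr, hDl, derivation_C, sub_zero, smul_eq_C_mul, ← map_mul]
    · rw [hLr, hDr, derivation_C, sub_zero, map_add, map_add, map_neg, seedLink_derivation_C_mul,
        hDl, hDl, hDl, ← map_mul, ← map_neg, ← map_add, ← map_add, smul_eq_C_mul, ← map_mul]
      congr 1
      rw [zpow_add_one₀ hz, zpow_sub_one₀ hz]
      have h2 : Pj.2 * (Pj.2 * Pj.1 ^ i) = Pj.2 ^ 2 * Pj.1 ^ i := by ring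
      rw [h2, hμ]
      ring
  have h := Derivation.congr_fun key f
  rw [Derivation.commutator_apply, Derivation.smul_apply] at h
  rw [← h]
  abel

/-- Iterated commutation with `L₁`: `𝐃 (L₁ f) = L₁ (𝐃 f) + (∑ μ_j) • 𝐃 f`. -/
theorem seedLink_fold_L (ω₂ : ℝ)
    {L : Derivation ℂ (MvPolynomial (ℤ ⊕ ℤ) ℂ) (MvPolynomial (ℤ ⊕ ℤ) ℂ)}
    (hLl : ∀ i : ℤ, L (X (Sum.inl i)) = X (Sum.inr i))
    (hLr : ∀ i : ℤ, L (X (Sum.inr i)) =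
      -(C ((ω₂ : ℂ) + 2) * X (Sum.inl i)) + X (Sum.inl (i + 1)) + X (Sum.inl (i - 1)))
    {D : ℂ × ℂ → Derivation ℂ (MvPolynomial (ℤ ⊕ ℤ) ℂ) (MvPolynomial (ℤ ⊕ ℤ) ℂ)}
    (hDl : ∀ (Pj : ℂ × ℂ) (x : ℤ), D Pj (X (Sum.inl x)) = C (Pj.1 ^ x))
    (hDr : ∀ (Pj : ℂ × ℂ) (x : ℤ), D Pj (X (Sum.inr x)) = C (Pj.2 * Pj.1 ^ x))
    (l : List (ℂ × ℂ)) (hl : ∀ Pj ∈ l, Pj.1 ≠ 0 ∧ Pj.2 ^ 2 = -((ω₂ : ℂ) + 2 - Pj.1 - (Pj.1)⁻¹))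
    (f : MvPolynomial (ℤ ⊕ ℤ) ℂ) :
    l.foldr (fun Pj acc => D Pj acc) (L f) =
      L (l.foldr (fun Pj acc => D Pj acc) f) + (l.map Prod.snd).sum • l.foldr (fun Pj acc => D Pj acc) f := by
  induction l with
  | nil => simp
  | cons Pj l ih =>
    have hPj := hl Pj (by simp)
    have ih' := ih (fun Q hQ => hl Q (by simp [hQ]))
    rw [List.foldr_cons, List.foldr_cons, ih', map_add, Derivation.map_smul,
      seedLink_D_L ω₂ hLl hLr hDl hDr Pj hPj.1 hPj.2, List.map_cons, List.sum_cons, add_smul,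
      add_assoc]

/-- The multiplier identity along a list of admissible waves:
`constantCoeff (𝐃 (𝒟₀ w)) = ((∑ μ_j) ^ 2 + ω̃(∏ z_j)) * constantCoeff (𝐃 w)`. -/
theorem seedLink_fold_D0 (ω₂ : ℝ)
    {L : Derivation ℂ (MvPolynomial (ℤ ⊕ ℤ) ℂ) (MvPolynomial (ℤ ⊕ ℤ) ℂ)}
    (hLl : ∀ i : ℤ, L (X (Sum.inl i)) = X (Sum.inr i))
    (hLr : ∀ i : ℤ, L (X (Sum.inr i)) =
      -(C ((ω₂ : ℂ) + 2) * X (Sum.inl i)) + X (Sum.inl (i + 1)) + X (Sum.inl (i - 1)))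
    {D : ℂ × ℂ → Derivation ℂ (MvPolynomial (ℤ ⊕ ℤ) ℂ) (MvPolynomial (ℤ ⊕ ℤ) ℂ)}
    (hDl : ∀ (Pj : ℂ × ℂ) (x : ℤ), D Pj (X (Sum.inl x)) = C (Pj.1 ^ x))
    (hDr : ∀ (Pj : ℂ × ℂ) (x : ℤ), D Pj (X (Sum.inr x)) = C (Pj.2 * Pj.1 ^ x))
    (l : List (ℂ × ℂ)) (hl : ∀ Pj ∈ l, Pj.1 ≠ 0 ∧ Pj.2 ^ 2 = -((ω₂ : ℂ) + 2 - Pj.1 - (Pj.1)⁻¹))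
    (w : MvPolynomial (ℤ ⊕ ℤ) ℂ) :
    constantCoeff (l.foldr (fun Pj acc => D Pj acc) (L (L w) + (C ((ω₂ : ℂ) + 2) * w -
      rename (Sum.map (fun i : ℤ => i + 1) (fun i : ℤ => i + 1)) w -
      rename (Sum.map (fun i : ℤ => i - 1) (fun i : ℤ => i - 1)) w))) =
      ((l.map Prod.snd).sum ^ 2 + ((ω₂ : ℂ) + 2 - (l.map Prod.fst).prod - ((l.map Prod.fst).prod)⁻¹)) *
        constantCoeff (l.foldr (fun Pj acc => D Pj acc) w) := by
  have hl1 : ∀ Pj ∈ l, Pj.1 ≠ 0 := fun Pj h => (hl Pj h).1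
  have hcL : ∀ f, constantCoeff (L f) = 0 := by
    refine seedLink_constantCoeff_derivation L (fun v => ?_)
    rcases v with i | i
    · rw [hLl, constantCoeff_X]
    · simp [hLr]
  rw [seedLink_fold_add, seedLink_fold_sub, seedLink_fold_sub, seedLink_fold_C_mul,
    seedLink_fold_L ω₂ hLl hLr hDl hDr l hl, seedLink_fold_L ω₂ hLl hLr hDl hDr l hl,
    seedLink_fold_tau hDl hDr l hl1, seedLink_fold_tauInv hDl hDr l hl1]
  simp only [map_add, map_sub, map_mul, constantCoeff_C, smul_eq_C_mul, hcL, constantCoeff_rename,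
    mul_add, mul_zero, zero_add]
  ring

/-- **Part (I) of the seed link** (the plane-wave multiplier of `𝒟₀`): for every tuple of
admissible waves `P`, `constantCoeff (𝐃_P (𝒟₀ w)) = t(P) * constantCoeff (𝐃_P w)` with
`t(P) = (∑ j, μ_j) ^ 2 + (ω₂ + 2 - ∏ j, z_j - (∏ j, z_j)⁻¹)`. -/
theorem seedLink_partI (ω₂ : ℝ)
    {L : Derivation ℂ (MvPolynomial (ℤ ⊕ ℤ) ℂ) (MvPolynomial (ℤ ⊕ ℤ) ℂ)}
    (hLl : ∀ i : ℤ, L (X (Sum.inl i)) = X (Sum.inr i))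
    (hLr : ∀ i : ℤ, L (X (Sum.inr i)) =
      -(C ((ω₂ : ℂ) + 2) * X (Sum.inl i)) + X (Sum.inl (i + 1)) + X (Sum.inl (i - 1)))
    {D : ℂ × ℂ → Derivation ℂ (MvPolynomial (ℤ ⊕ ℤ) ℂ) (MvPolynomial (ℤ ⊕ ℤ) ℂ)}
    (hDl : ∀ (Pj : ℂ × ℂ) (x : ℤ), D Pj (X (Sum.inl x)) = C (Pj.1 ^ x))
    (hDr : ∀ (Pj : ℂ × ℂ) (x : ℤ), D Pj (X (Sum.inr x)) = C (Pj.2 * Pj.1 ^ x))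
    {n : ℕ} (P : Fin n → ℂ × ℂ)
    (hP : ∀ j, (P j).1 ≠ 0 ∧ (P j).2 ^ 2 = -((ω₂ : ℂ) + 2 - (P j).1 - ((P j).1)⁻¹))
    (w : MvPolynomial (ℤ ⊕ ℤ) ℂ) :
    constantCoeff ((List.ofFn P).foldr (fun Pj acc => D Pj acc) (L (L w) + (C ((ω₂ : ℂ) + 2) * w -
      rename (Sum.map (fun i : ℤ => i + 1) (fun i : ℤ => i + 1)) w -
      rename (Sum.map (fun i : ℤ => i - 1) (fun i : ℤ => i - 1)) w))) =
      ((∑ j, (P j).2) ^ 2 + ((ω₂ : ℂ) + 2 - (∏ j, (P j).1) - (∏ j, (P j).1)⁻¹)) *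
        constantCoeff ((List.ofFn P).foldr (fun Pj acc => D Pj acc) w) := by
  have hl : ∀ Pj ∈ List.ofFn P, Pj.1 ≠ 0 ∧ Pj.2 ^ 2 = -((ω₂ : ℂ) + 2 - Pj.1 - (Pj.1)⁻¹) := by
    intro Pj hPj
    obtain ⟨j, rfl⟩ := List.mem_ofFn.1 hPj
    exact hP j
  rw [seedLink_fold_D0 ω₂ hLl hLr hDl hDr _ hl, List.map_ofFn, List.map_ofFn, List.sum_ofFn,
    List.prod_ofFn]
  rfl

/-- **Registered anchor `stub_seedLink_partI` of this helper file** (closed form of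
`seedLink_partI`): the plane-wave multiplier identity for the harmonic linearised operator,
for abstract derivations characterised on generators. -/
theorem stub_seedLink_partI :
    ∀ (ω₂ : ℝ) (L : Derivation ℂ (MvPolynomial (ℤ ⊕ ℤ) ℂ) (MvPolynomial (ℤ ⊕ ℤ) ℂ)),
      (∀ i : ℤ, L (MvPolynomial.X (Sum.inl i)) = MvPolynomial.X (Sum.inr i)) →
      (∀ i : ℤ, L (MvPolynomial.X (Sum.inr i)) = -(MvPolynomial.C ((ω₂ : ℂ) + 2) * MvPolynomial.X (Sum.inl i)) + MvPolynomial.X (Sum.inl (i + 1)) + MvPolynomial.X (Sum.inl (i - 1))) →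
      ∀ (D : ℂ × ℂ → Derivation ℂ (MvPolynomial (ℤ ⊕ ℤ) ℂ) (MvPolynomial (ℤ ⊕ ℤ) ℂ)),
      (∀ (Pj : ℂ × ℂ) (x : ℤ), D Pj (MvPolynomial.X (Sum.inl x)) = MvPolynomial.C (Pj.1 ^ x)) →
      (∀ (Pj : ℂ × ℂ) (x : ℤ), D Pj (MvPolynomial.X (Sum.inr x)) = MvPolynomial.C (Pj.2 * Pj.1 ^ x)) →
      ∀ (n : ℕ) (P : Fin n → ℂ × ℂ), (∀ j, (P j).1 ≠ 0 ∧ (P j).2 ^ 2 = -((ω₂ : ℂ) + 2 - (P j).1 - ((P j).1)⁻¹)) →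
      ∀ w : MvPolynomial (ℤ ⊕ ℤ) ℂ,
      MvPolynomial.constantCoeff ((List.ofFn P).foldr (fun Pj acc => D Pj acc) (L (L w) + (MvPolynomial.C ((ω₂ : ℂ) + 2) * w - MvPolynomial.rename (Sum.map (fun i : ℤ => i + 1) (fun i : ℤ => i + 1)) w - MvPolynomial.rename (Sum.map (fun i : ℤ => i - 1) (fun i : ℤ => i - 1)) w))) = ((∑ j, (P j).2) ^ 2 + ((ω₂ : ℂ) + 2 - (∏ j, (P j).1) - (∏ j, (P j).1)⁻¹)) * MvPolynomial.constantCoeff ((List.ofFn P).foldr (fun Pj acc => D Pj acc) w) :=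
  fun ω₂ _ hLl hLr _ hDl hDr _ P hP w => seedLink_partI ω₂ hLl hLr hDl hDr P hP w

end Summit.AtomisticToContinuum.FouriersLaw.Theorems.DressedCharge

end
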